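import Mathlib
import HarnessLib
import Summits.HubbardSuperconductivity.HubbardSuperconductivity.Theorems.KLProgrammeKLRegimeEngineV8E5WitnessRows
import Summits.HubbardSuperconductivity.HubbardSuperconductivity.Theorems.KLProgrammeKLRegimeEngineWtBudget

/-!
# Route `KLProgramme` — ENGINE child gen 8 (stmt-HubbardSuperconductivity-20437 `KLRegimeEngineV17F2`), SKELETON v2 class #3, PROVING side:
# the per-step E.5 block bound GENERIC IN THE COUPLING SIZE `g`, its U-keyed instance (the interface of record) and its ε-keyed instance (the gap)
# (cell gate-hubbard-kl, seat p5 g10; assembly part 7; plan g20 (R71)/(R71a): class-#3 T-day deliverable of record; located risk #14 «(c)-E5-EPS»)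

WHY.  The entry point of record `exists_e5Pkg2_of_stepDataRows` (…E5WitnessRows, p573937) keys the carrier law (RA) at `(P.Klam·U)^{m/2−1}` and
closes the class-#3 `∃ (C,u), E5ShareStep2 P R C u`, whose target `C·(P.Klam·U)³·2^{−n}` is the currency of `eremBar`'s `Q.CR·(P.Klam·|U|)³·2^{−n}`
inside the FROZEN (E2-F2) slot (`PairLadderStepAtV17F2` ∈ `klPredsV17F2.engine`, consumed by the closed child 1).  The E1 tower's levelled law is
registered in the currency `Q.CE^p · ε_j^{p−1} · …` of the sign-blind RUNNING coupling `ε_j = epsCoupling P U j = Klam·(|U| + U²·j)` (…SplitPredicatesV3),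
and `ε_{n−2}/(Klam·U) = 1 + U·(n−2)` is unbounded in the regime (`U²·n·ln 4 ≤ cc`).  Every arithmetic step of the witness — §3 of …E5WitnessSlice (`X`
free), §7 `klE5_vertexPackage_of_levelLaw` (law keyed at a free `g ≥ 0`), `klE5_share_arith` (`X` free) — is currency-agnostic; only the TARGET pins
`(Klam·U)³`.  This file therefore states the per-step bound ONCE for an arbitrary coupling size `g` (§11) and instantiates it twice: at `g := P.Klam·U`
(§12a, the INTERFACE OF RECORD toward (E2-F2) — p573937's step, per step and threshold-explicit) and at `g := ε_{n−2}` (§12b, what an ε-keyed supplier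
feeds today): the per-step cube then is `ε_{n−2}³ = (Klam·U)³·(1 + U(n−2))³` (FINDING (E5-EPS) = located risk #14, KL STATUS 2026-08-27 (R71a)) — sums
stay U-cubed (`…EngineE5BudgetDecay`), the per-step slot does not.

THE OPEN INPUT OF RECORD «(RA-U)» (plan g20 (R71a)(3); under the `E5ShareStep2` binders, `K := klFlowFrameU L M β U μ n`, `3 ≤ n`, `Λ ∈ [Λ_n, Λ_{n−1}]`,
labels `Qm x y` on the bare ball; table `C₀Θ^{m/2}` with `0 ≤ C₀`, `1 ≤ Θ`; the hypothesis `hlaw` of §11/§12a VERBATIM at `g := P.Klam * U`):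
  `∀ m : ℕ, 4 ≤ m → Even m → ∀ Ωe : Fin m → Option (SectorLeg (sectorCount (n - 2) + 4)),`
  `  hubbardSectorKernelNorm L M β (pointAugment (klAnisoFamily L M β μ K klE0 (n - 2)) (klE5ExtMomenta Qm x y)) (prescribedTuples univ Ωe)`
  `    (klE5Carrier L M β μ K (n - 1) (klE5Kappa L M β U μ K (n - 1)) (klE5Input L M β U μ K (n - 1)) Λ) ≤`
  `    C₀ * Θ ^ (m / 2) * (P.Klam * U) ^ (m / 2 - 1) * (2 : ℝ) ^ ((3 * (m / 2) - 5) * (n - 2)) * (((2 : ℝ) ^ (n - 2))⁻¹) ^ levelGainExp (levelCount Ωe)`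
together with its odd clause (`¬ Even m ⇒ ≤ 0`, which `hubbardSectorKernelNorm_eq_zero_of_evenOdd_zero_of_not_even` gives from evenness of the carrier)
— a U-KEYED levelled law for the Wick carrier `W_Λ` along the dressed slice (degrees 4, 6, 8, … with the level gain on EVERY degree incl. the quartic, r18a).
Supplier question of record: (Q-E1-RA-U) (E1: can the tower export the cubic classes' sextic/octic levels U-keyed — E1-WORD-QE1-I2-g8 (Q-E1)(a) says the law
runs at `λ = B·Klam·U` given the quartic import in U-currency, condition «S3 in U-currency»).

* §11 **`klE5BlockR1_slice_le_of_rows_generic`** — `∃ Cκ > 0` (k3c2-p2's Gram constant, absolute): under the WEAKEST stub doors the Gram lemma reads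
  (`cc ≤ klEngC₃3`, `U ≤ klEngU₀4`, `klEngL₃ β U ≤ L`, `klEngM₃`), ANY admissible frame `K` (`FrameOK`), a step `3 ≤ n ≤ nScales β + 1`,
  `Λ ∈ [Λ_n, Λ_{n−1}]`: from (L1) the row/column sums `α` of the rescaled dressed derivative line on the fat family of level `n−2`
  (`α ≤ λ·Cα·ε⁻¹·16^n/e₀²`), (SM) the dressing smallness at `Λ_n` and `Λ`, (RA-g) ONE levelled-norm law of the carrier keyed at `g`
  (table `C₀Θ^{m/2}`, gain on every degree, odd prescriptions `0`) and the smallness `528·Cκ·e₀·Θ·g ≤ 1`: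
  `‖klE5BlockR1 … K (n−1) Λ Qm x y‖·(Λ_{n−1} − Λ_n) ≤ ((4!·13⁴·1680·2⁹·88²·3·(16Cα)·(512Cκ)²·CA)·e₀)·g³·2^{−n}`;
* §12a **`klE5BlockR1_slice_le_of_rows_klam`** — the INTERFACE OF RECORD: `g := P.Klam·U` under the n-free threshold `U ≤ 1/(528·Cκ·e₀·Θ·max(Klam,1))`
  (p573937's `u₀`), conclusion `≤ C·e₀·(P.Klam·U)³·2^{−n}` = `E5ShareStep2`'s currency, per step, at any admissible frame;
* §12b **`klE5BlockR1_slice_le_of_rows_eps`** — the instance `g := epsCoupling P U (n−2)` (`0 ≤ ε` from `P.WF`; smallness `528·Cκ·e₀·Θ·ε_{n−2} ≤ 1`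
  kept as a hypothesis — it is a `cc`-smallness in the regime, (E5-EPS-cc)), and `klE5BlockR1_slice_le_of_rows_eps'` with the cube presented at `ε_n`;
* §13 `epsCoupling_eq_klam_abs_mul` (`ε_j = Klam·|U|·(1 + |U|·j)`), `epsCoupling_mono`, `epsCoupling_pow_three_eq` (the excess `(1 + U·j)³` as an
  identity) — the currency dictionary.

Pure composition + real bookkeeping; no definitions, no named facts, nothing about the model's sizes is asserted (rows, smallness and law are
hypotheses); nothing asserts superconductivity.
-/
noncomputable section

namespace Summit.HubbardSuperconductivity.HubbardSuperconductivity.Theorems.KLRegimeSplit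

set_option linter.dupNamespace false -- summit = problem name (single-conjunct summit), D-0017

open Real Finset Literature.MathematicalPhysics.QuantumLattice Literature.Probability.LatticeModels GrassmannAlgebra Matrix
open Literature.MathematicalPhysics.QuantumLattice.FermiRG
open Summit.HubbardSuperconductivity.HubbardSuperconductivity.Theorems.KLProgrammeLegKernels
open Summit.HubbardSuperconductivity.HubbardSuperconductivity.Theorems.KLRegimeWick
open Summit.HubbardSuperconductivity.HubbardSuperconductivity.Theorems.EngineV8
open Summit.HubbardSuperconductivity.HubbardSuperconductivity.Theorems.TwoPointAssembly
open Summit.HubbardSuperconductivity.HubbardSuperconductivity.Theorems.TorusFourierL2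
open Summit.HubbardSuperconductivity.HubbardSuperconductivity.Theorems.DispersionFlow

/-! ## §13 The currency dictionary (stated first: used in §12) -/

/-- **`ε_j = Klam·|U|·(1 + |U|·j)`** — the sign-blind running coupling against the U-currency unit. [folklore] -/
theorem epsCoupling_eq_klam_abs_mul (P : SplitConsts) (U : ℝ) (j : ℕ) : epsCoupling P U j = P.Klam * |U| * (1 + |U| * j) := by
  unfold epsCoupling
  rw [← sq_abs U]
  ring

/-- **`ε` is monotone in the scale index** (`0 ≤ Klam`). [folklore] -/
theorem epsCoupling_mono {P : SplitConsts} (hK : 0 ≤ P.Klam) (U : ℝ) {i j : ℕ} (hij : i ≤ j) : epsCoupling P U i ≤ epsCoupling P U j := by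
  unfold epsCoupling
  have h : (i : ℝ) ≤ j := by exact_mod_cast hij
  exact mul_le_mul_of_nonneg_left (by nlinarith [sq_nonneg U]) hK

/-- For `0 < U`: `(Klam·U)³·(1 + U·j)³ = ε_j³` — the per-step excess of the ε-cube over the U-cube is `(1 + U·j)³`. [folklore] -/
theorem epsCoupling_pow_three_eq {P : SplitConsts} {U : ℝ} (hU : 0 < U) (j : ℕ) :
    epsCoupling P U j ^ 3 = (P.Klam * U) ^ 3 * (1 + U * j) ^ 3 := by
  rw [epsCoupling_eq_klam_abs_mul, abs_of_pos hU]
  ring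

/-! ## §11 The per-step E.5 block bound, generic in the coupling size `g` -/

section Generic

/-- **The per-step (R1′) E.5 block bound, GENERIC IN THE COUPLING SIZE `g`.**  There is an absolute `Cκ > 0` (the Gram constant of k3c2-p2's
`gram_softShaped_bgmFat_sharp_klEng`) such that, under the weakest stub doors that lemma reads, for ANY admissible frame `K`, any step `3 ≤ n ≤ nScales β + 1`,
`Λ ∈ [Λ_n, Λ_{n−1}]`, any labels, any nonnegative `Cα`, `C₀`, table growth `Θ ≥ 1`, `CA ≥ C₀²Θ⁵/64` and coupling size `g ≥ 0` with `528·Cκ·e₀·Θ·g ≤ 1`: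
(L1) row/column sums `α` of the rescaled dressed derivative line on the fat family of level `n−2` with `α ≤ λ·Cα·ε⁻¹·16^n/e₀²`, (SM) the dressing smallness
at `Λ_n` and `Λ`, and (RA-g) the carrier's levelled-norm law keyed at `g` (odd prescriptions `0`) give
`‖klE5BlockR1 … K (n−1) Λ Qm x y‖·(Λ_{n−1} − Λ_n) ≤ ((4!·13⁴·1680·2⁹·88²·3·(16Cα)·(512Cκ)²·CA)·e₀)·g³·2^{−n}` — every Gram datum and the envelope
discharged inside (`A_p = 256` for `λ·ċ_Λ`, `A_p = 8` for the soft line; Gram base `264·Cκ·e₀·8^{−(n−2)}`).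
[cite: BenfattoGiulianiMastropietro2006, §2.8 (2.80); Lemma 2.5 (2.98)] -/
theorem klE5BlockR1_slice_le_of_rows_generic :
    ∃ Cκ : ℝ, 0 < Cκ ∧ ∀ (P : SplitConsts) (R : RenConsts) (cc : ℝ), P.WF → R.WF2 → 0 < cc → cc ≤ klEngC₃3 P R →
      ∀ μ ∈ klWindowC, ∀ U : ℝ, 0 < U → U ≤ klEngU₀4 P R cc → ∀ β : ℝ, klBetaMin ≤ β → β ≤ Real.exp (cc / U ^ 2) →
      ∀ K : TrigPolyC4v, FrameOK R U (nScales β) μ K → ∀ (L M : ℕ) [NeZero L] [NeZero M],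
      klEngL₃ β U ≤ L → klEngM₃ β U L ≤ M → ∀ n : ℕ, 3 ≤ n → n ≤ nScales β + 1 →
      ∀ Λ ∈ Set.Icc (klScale klE0 n) (klScale klE0 (n - 1)), ∀ (Qm : TorusSite 2 L) (x y : TorusSite 2 L × MatsubaraIdx M),
      ∀ (Cα C₀ Θ CA g : ℝ), 0 ≤ Cα → 0 ≤ C₀ → 1 ≤ Θ → C₀ ^ 2 * Θ ^ 5 / 64 ≤ CA → 0 ≤ g → 528 * Cκ * klE0 * Θ * g ≤ 1 →
      ∀ α : ℝ, 0 ≤ α →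
        (∀ X, ∑ Y, ‖((sectorSubMatrix L M β (bgmFatMultiplier L M klE0 β (nambuXiCT L μ K) (n - 2))).transpose *
          normalCovariance L M (fun ks => ((klScale klE0 (n - 1) - klScale klE0 n : ℝ) : ℂ) *
            klE5DerivLineSym L M β μ K (n - 1) (klE5Kappa L M β U μ K (n - 1)) Λ ks) *
          sectorSubMatrix L M β (bgmFatMultiplier L M klE0 β (nambuXiCT L μ K) (n - 2))) X Y‖ ≤ α) →
        (∀ Y, ∑ X, ‖((sectorSubMatrix L M β (bgmFatMultiplier L M klE0 β (nambuXiCT L μ K) (n - 2))).transpose *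
          normalCovariance L M (fun ks => ((klScale klE0 (n - 1) - klScale klE0 n : ℝ) : ℂ) *
            klE5DerivLineSym L M β μ K (n - 1) (klE5Kappa L M β U μ K (n - 1)) Λ ks) *
          sectorSubMatrix L M β (bgmFatMultiplier L M klE0 β (nambuXiCT L μ K) (n - 2))) X Y‖ ≤ α) →
        (∀ ks : FreqMomentum L M × Fin 2, ‖klE5SliceSym L M β μ K (n - 1) (klScale klE0 n) ks * klE5Kappa L M β U μ K (n - 1) ks‖ ≤ 1 / 2 ∧
          ‖klE5SliceSym L M β μ K (n - 1) Λ ks * klE5Kappa L M β U μ K (n - 1) ks‖ ≤ 1 / 2) →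
        (∀ m : ℕ, 4 ≤ m → Even m → ∀ Ωe : Fin m → Option (SectorLeg (sectorCount (n - 2) + 4)),
          hubbardSectorKernelNorm L M β (pointAugment (klAnisoFamily L M β μ K klE0 (n - 2)) (klE5ExtMomenta Qm x y)) (prescribedTuples univ Ωe)
            (klE5Carrier L M β μ K (n - 1) (klE5Kappa L M β U μ K (n - 1)) (klE5Input L M β U μ K (n - 1)) Λ) ≤
            C₀ * Θ ^ (m / 2) * g ^ (m / 2 - 1) * (2 : ℝ) ^ ((3 * (m / 2) - 5) * (n - 2)) * (((2 : ℝ) ^ (n - 2))⁻¹) ^ levelGainExp (levelCount Ωe)) →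
        (∀ m : ℕ, ¬ Even m → ∀ Ωe : Fin m → Option (SectorLeg (sectorCount (n - 2) + 4)),
          hubbardSectorKernelNorm L M β (pointAugment (klAnisoFamily L M β μ K klE0 (n - 2)) (klE5ExtMomenta Qm x y)) (prescribedTuples univ Ωe)
            (klE5Carrier L M β μ K (n - 1) (klE5Kappa L M β U μ K (n - 1)) (klE5Input L M β U μ K (n - 1)) Λ) ≤ 0) →
        α ≤ (klScale klE0 (n - 1) - klScale klE0 n) * (Cα * (imagTimeWeight β M)⁻¹ * (16 : ℝ) ^ n / klE0 ^ 2) →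
        ‖klE5BlockR1 L M β U μ K (n - 1) Λ Qm x y‖ * (klScale klE0 (n - 1) - klScale klE0 n) ≤
          ((((4 : ℕ).factorial : ℝ) * 13 ^ 4 * (1680 * 2 ^ 9) * 88 ^ 2 * 3 * (16 * Cα) * (512 * Cκ) ^ 2 * CA) * klE0) * g ^ 3 * ((2 : ℝ) ^ n)⁻¹ := by
  obtain ⟨Cκ, hCκ, hGram⟩ := gram_softShaped_bgmFat_sharp_klEng
  refine ⟨Cκ, hCκ, ?_⟩
  intro P R cc hP hR hcc hcc3 μ hμ U hU hU4 β hβ hβc K hF L M _ _ hL hM n h3n hnN Λ hΛ Qm x y Cα C₀ Θ CA g hCα hC₀ hΘ hCA hg hsmall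
    α hα hrow hcol hsm hlaw hodd hαs
  have he₀ : (0 : ℝ) < klE0 := by norm_num [klE0]
  have hβpos : 0 < β := pos_of_klBetaMin_le hβ
  have hβ0 : 0 ≤ β := hβpos.le
  have hΛ0 : 0 < Λ := lt_of_lt_of_le (by unfold klScale; positivity) hΛ.1
  have hn : 1 ≤ n := by omega
  -- the slice measure `λ = 3Λ_n ≤ 3Λ`
  have hlam : klScale klE0 (n - 1) - klScale klE0 n = 3 * klScale klE0 n := by
    rw [klScale_pred_sub_eq klE0 hn, klScale]; ring
  have hlam0 : 0 ≤ klScale klE0 (n - 1) - klScale klE0 n := by rw [hlam]; unfold klScale; positivity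
  have hlam3 : klScale klE0 (n - 1) - klScale klE0 n ≤ 3 * Λ := by rw [hlam]; exact mul_le_mul_of_nonneg_left hΛ.1 (by norm_num)
  -- the generic sharp Gram lemma at the fat family of level `n−2`
  have hG' := hGram P R cc hP hR hcc hcc3 μ hμ U hU hU4 β hβ hβc K hF L M hL hM (n - 2) (by omega) (by omega)
  -- line 0 (rescaled dressed derivative): `A_p = 256`
  obtain ⟨-, -, hκF₀, hκG₀⟩ := hG' (fun ks => ((klScale klE0 (n - 1) - klScale klE0 n : ℝ) : ℂ) *
      klE5DerivLineSym L M β μ K (n - 1) (klE5Kappa L M β U μ K (n - 1)) Λ ks) 256 (by norm_num)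
    (fun ks _ => norm_scaled_klE5DerivLineSym_le_div_radius β μ K (n - 1) _ hβ0 hΛ0 hlam0 hlam3 ks (hsm ks).2)
  -- line 1 (dressed soft line): `A_p = 8`
  have hsm' : ∀ ks : FreqMomentum L M × Fin 2,
      ‖klE5SliceSym L M β μ K (n - 1) (klScale klE0 (n - 1 + 1)) ks * klE5Kappa L M β U μ K (n - 1) ks‖ ≤ 1 / 2 := by
    rw [Nat.sub_add_cancel hn]; exact fun ks => (hsm ks).1
  obtain ⟨hent, -, hκF₁, hκG₁⟩ := hG' (klE5SoftLineSym L M β μ K (n - 1) (klE5Kappa L M β U μ K (n - 1)) Λ)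
    8 (by norm_num) (fun ks _ => norm_klE5SoftLineSym_le_div_radius (L := L) (M := M) β μ K (n - 1) _ hβ0 ks (hsm' ks) (hsm ks).2)
  -- the vertex package from the law, Gram base `264·Cκ·e₀·8^{−(n−2)}`
  have hΘ0 : 0 < Θ := zero_lt_one.trans_le hΘ
  have hκs0 : (0 : ℝ) ≤ 264 * Cκ * (klE0 * ((8 : ℝ) ^ (n - 2))⁻¹) := by positivity
  have hsmall' : 264 * Cκ * (klE0 * ((8 : ℝ) ^ (n - 2))⁻¹) * Θ * g * (8 : ℝ) ^ (n - 2) ≤ 1 / 2 := by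
    have h8 : (8 : ℝ) ^ (n - 2) ≠ 0 := pow_ne_zero _ (by norm_num)
    have e : 264 * Cκ * (klE0 * ((8 : ℝ) ^ (n - 2))⁻¹) * Θ * g * (8 : ℝ) ^ (n - 2) = (528 * Cκ * klE0 * Θ * g) / 2 := by
      field_simp
      ring
    rw [e]
    linarith
  obtain ⟨Nf, Ne, x', A, hNe0, hNf, hNe, hx0, hx1, hA, henv, hAs⟩ :=
    klE5_vertexPackage_of_levelLaw β (pointAugment (klAnisoFamily L M β μ K klE0 (n - 2)) (klE5ExtMomenta Qm x y))
      (klE5Carrier L M β μ K (n - 1) (klE5Kappa L M β U μ K (n - 1)) (klE5Input L M β U μ K (n - 1)) Λ) (show 2 ≤ n by omega)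
      hg hC₀ hΘ hκs0 hlaw hodd hsmall'
  have hbase : Real.sqrt (256 * Cκ * (klE0 * ((8 : ℝ) ^ (n - 2))⁻¹)) ^ 2 + Real.sqrt (8 * Cκ * (klE0 * ((8 : ℝ) ^ (n - 2))⁻¹)) ^ 2 =
      264 * Cκ * (klE0 * ((8 : ℝ) ^ (n - 2))⁻¹) := by
    rw [Real.sq_sqrt (by positivity), Real.sq_sqrt (by positivity)]; ring
  have henv' : ∀ q ∈ Icc 1 4, ∀ k ∈ Icc 3 (Fintype.card (HubbardFieldIdx L M × Fin 2) + 2),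
      (Real.sqrt (256 * Cκ * (klE0 * ((8 : ℝ) ^ (n - 2))⁻¹)) ^ 2 + Real.sqrt (8 * Cκ * (klE0 * ((8 : ℝ) ^ (n - 2))⁻¹)) ^ 2) ^ (k - 3) *
        ((imagTimeWeight β M * Nf k q) * (imagTimeWeight β M * Ne k (4 - q))) ≤ x' ^ (k - 3) * A := by
    intro q hq k hk
    rw [hbase]
    exact henv q hq k hk
  -- `δ = 8·Cκ·e₀·8^{−(n−2)} = 512·Cκ·e₀·8^{−n}`
  have hδs : 8 * Cκ * (klE0 * ((8 : ℝ) ^ (n - 2))⁻¹) ≤ (512 * Cκ) * klE0 * ((8 : ℝ) ^ n)⁻¹ := by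
    have h8 : ((8 : ℝ) ^ (n - 2))⁻¹ = 64 * ((8 : ℝ) ^ n)⁻¹ := by
      have e : (8 : ℝ) ^ n = (8 : ℝ) ^ (n - 2) * 64 := by
        rw [show (64 : ℝ) = 8 ^ 2 by norm_num, ← pow_add, Nat.sub_add_cancel (by omega : 2 ≤ n)]
      have h0 : (8 : ℝ) ^ (n - 2) ≠ 0 := pow_ne_zero _ (by norm_num)
      rw [e, mul_inv]
      field_simp
    rw [h8]
    refine le_of_eq ?_
    ring
  -- `A ≤ CA·ε²·g³·8^n`
  have hAs' : A ≤ CA * imagTimeWeight β M ^ 2 * g ^ 3 * (8 : ℝ) ^ n :=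
    hAs.trans (mul_le_mul_of_nonneg_right (mul_le_mul_of_nonneg_right (mul_le_mul_of_nonneg_right hCA (sq_nonneg _)) (pow_nonneg hg 3))
      (by positivity))
  -- §3 of `…E5WitnessSlice` with `X := g³`, then the (R1′) unfolding
  have h := klE5Block_slice_le_of_stepData_klAniso β μ K (klE5Kappa L M β U μ K (n - 1)) (klE5Input L M β U μ K (n - 1)) Λ Qm x y hβpos h3n hΛ
    hα (Real.sqrt_nonneg _) (by positivity) (Real.sqrt_nonneg _) hrow hcol (fun Y _ => hκF₀ Y) (fun Y _ => hκG₀ Y) hent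
    (fun Y _ => hκF₁ Y) (fun Y _ => hκG₁ Y) Nf Ne hNe0 hNf hNe hx0 hx1 hA henv' hαs hδs hAs'
  unfold klE5BlockR1
  refine h.trans (le_of_eq ?_)
  ring

end Generic

/-! ## §12a The interface of record: `g := P.Klam·U` under the n-free threshold -/

section Klam

/-- **The per-step (R1′) E.5 block bound in the currency of record** `g := P.Klam·U` (the U-cube of `E5ShareStep2` / `eremBar`'s `Q.CR·(P.Klam·|U|)³·2^{−n}`):
under §11's binders, the U-KEYED law «(RA-U)» and the n-free threshold `U ≤ 1/(528·Cκ·e₀·Θ·max(Klam,1))` (p573937's `u₀`, which closes the line-number tail),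
`‖klE5BlockR1 … K (n−1) Λ Qm x y‖·(Λ_{n−1} − Λ_n) ≤ ((4!·13⁴·1680·2⁹·88²·3·(16Cα)·(512Cκ)²·CA)·e₀)·(P.Klam·U)³·2^{−n}` — p573937's step, per step and at any
admissible frame. [cite: BenfattoGiulianiMastropietro2006, §2.8 (2.80); Lemma 2.5 (2.98)] -/
theorem klE5BlockR1_slice_le_of_rows_klam :
    ∃ Cκ : ℝ, 0 < Cκ ∧ ∀ (P : SplitConsts) (R : RenConsts) (cc : ℝ), P.WF → R.WF2 → 0 < cc → cc ≤ klEngC₃3 P R →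
      ∀ μ ∈ klWindowC, ∀ U : ℝ, 0 < U → U ≤ klEngU₀4 P R cc → ∀ β : ℝ, klBetaMin ≤ β → β ≤ Real.exp (cc / U ^ 2) →
      ∀ K : TrigPolyC4v, FrameOK R U (nScales β) μ K → ∀ (L M : ℕ) [NeZero L] [NeZero M],
      klEngL₃ β U ≤ L → klEngM₃ β U L ≤ M → ∀ n : ℕ, 3 ≤ n → n ≤ nScales β + 1 →
      ∀ Λ ∈ Set.Icc (klScale klE0 n) (klScale klE0 (n - 1)), ∀ (Qm : TorusSite 2 L) (x y : TorusSite 2 L × MatsubaraIdx M),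
      ∀ (Cα C₀ Θ CA : ℝ), 0 ≤ Cα → 0 ≤ C₀ → 1 ≤ Θ → C₀ ^ 2 * Θ ^ 5 / 64 ≤ CA → U ≤ 1 / (528 * Cκ * klE0 * Θ * max P.Klam 1) →
      ∀ α : ℝ, 0 ≤ α →
        (∀ X, ∑ Y, ‖((sectorSubMatrix L M β (bgmFatMultiplier L M klE0 β (nambuXiCT L μ K) (n - 2))).transpose *
          normalCovariance L M (fun ks => ((klScale klE0 (n - 1) - klScale klE0 n : ℝ) : ℂ) *
            klE5DerivLineSym L M β μ K (n - 1) (klE5Kappa L M β U μ K (n - 1)) Λ ks) *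
          sectorSubMatrix L M β (bgmFatMultiplier L M klE0 β (nambuXiCT L μ K) (n - 2))) X Y‖ ≤ α) →
        (∀ Y, ∑ X, ‖((sectorSubMatrix L M β (bgmFatMultiplier L M klE0 β (nambuXiCT L μ K) (n - 2))).transpose *
          normalCovariance L M (fun ks => ((klScale klE0 (n - 1) - klScale klE0 n : ℝ) : ℂ) *
            klE5DerivLineSym L M β μ K (n - 1) (klE5Kappa L M β U μ K (n - 1)) Λ ks) *
          sectorSubMatrix L M β (bgmFatMultiplier L M klE0 β (nambuXiCT L μ K) (n - 2))) X Y‖ ≤ α) →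
        (∀ ks : FreqMomentum L M × Fin 2, ‖klE5SliceSym L M β μ K (n - 1) (klScale klE0 n) ks * klE5Kappa L M β U μ K (n - 1) ks‖ ≤ 1 / 2 ∧
          ‖klE5SliceSym L M β μ K (n - 1) Λ ks * klE5Kappa L M β U μ K (n - 1) ks‖ ≤ 1 / 2) →
        (∀ m : ℕ, 4 ≤ m → Even m → ∀ Ωe : Fin m → Option (SectorLeg (sectorCount (n - 2) + 4)),
          hubbardSectorKernelNorm L M β (pointAugment (klAnisoFamily L M β μ K klE0 (n - 2)) (klE5ExtMomenta Qm x y)) (prescribedTuples univ Ωe)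
            (klE5Carrier L M β μ K (n - 1) (klE5Kappa L M β U μ K (n - 1)) (klE5Input L M β U μ K (n - 1)) Λ) ≤
            C₀ * Θ ^ (m / 2) * (P.Klam * U) ^ (m / 2 - 1) * (2 : ℝ) ^ ((3 * (m / 2) - 5) * (n - 2)) *
              (((2 : ℝ) ^ (n - 2))⁻¹) ^ levelGainExp (levelCount Ωe)) →
        (∀ m : ℕ, ¬ Even m → ∀ Ωe : Fin m → Option (SectorLeg (sectorCount (n - 2) + 4)),
          hubbardSectorKernelNorm L M β (pointAugment (klAnisoFamily L M β μ K klE0 (n - 2)) (klE5ExtMomenta Qm x y)) (prescribedTuples univ Ωe)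
            (klE5Carrier L M β μ K (n - 1) (klE5Kappa L M β U μ K (n - 1)) (klE5Input L M β U μ K (n - 1)) Λ) ≤ 0) →
        α ≤ (klScale klE0 (n - 1) - klScale klE0 n) * (Cα * (imagTimeWeight β M)⁻¹ * (16 : ℝ) ^ n / klE0 ^ 2) →
        ‖klE5BlockR1 L M β U μ K (n - 1) Λ Qm x y‖ * (klScale klE0 (n - 1) - klScale klE0 n) ≤
          ((((4 : ℕ).factorial : ℝ) * 13 ^ 4 * (1680 * 2 ^ 9) * 88 ^ 2 * 3 * (16 * Cα) * (512 * Cκ) ^ 2 * CA) * klE0) *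
            (P.Klam * U) ^ 3 * ((2 : ℝ) ^ n)⁻¹ := by
  obtain ⟨Cκ, hCκ, h⟩ := klE5BlockR1_slice_le_of_rows_generic
  refine ⟨Cκ, hCκ, ?_⟩
  intro P R cc hP hR hcc hcc3 μ hμ U hU hU4 β hβ hβc K hF L M _ _ hL hM n h3n hnN Λ hΛ Qm x y Cα C₀ Θ CA hCα hC₀ hΘ hCA hUu₀
    α hα hrow hcol hsm hlaw hodd hαs
  have hK : 0 ≤ P.Klam := zero_le_one.trans hP.1
  have he₀ : (0 : ℝ) < klE0 := by norm_num [klE0]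
  have hΘ0 : 0 < Θ := zero_lt_one.trans_le hΘ
  have hmax : 0 < max P.Klam 1 := lt_max_of_lt_right one_pos
  -- the threshold closes the line-number tail: `528·Cκ·e₀·Θ·(Klam·U) ≤ 528·Cκ·e₀·Θ·max(Klam,1)·u₀ = 1`
  have hsmall : 528 * Cκ * klE0 * Θ * (P.Klam * U) ≤ 1 := by
    have hKU : P.Klam * U ≤ max P.Klam 1 * (1 / (528 * Cκ * klE0 * Θ * max P.Klam 1)) := mul_le_mul (le_max_left _ _) hUu₀ hU.le hmax.le
    have h1 : 528 * Cκ * klE0 * Θ * (max P.Klam 1 * (1 / (528 * Cκ * klE0 * Θ * max P.Klam 1))) = 1 := by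
      field_simp
    calc 528 * Cκ * klE0 * Θ * (P.Klam * U) ≤ 528 * Cκ * klE0 * Θ * (max P.Klam 1 * (1 / (528 * Cκ * klE0 * Θ * max P.Klam 1))) :=
          mul_le_mul_of_nonneg_left hKU (by positivity)
      _ = 1 := h1
  exact h P R cc hP hR hcc hcc3 μ hμ U hU hU4 β hβ hβc K hF L M hL hM n h3n hnN Λ hΛ Qm x y Cα C₀ Θ CA (P.Klam * U) hCα hC₀ hΘ hCA
    (mul_nonneg hK hU.le) hsmall α hα hrow hcol hsm hlaw hodd hαs

end Klam

/-! ## §12b The instance at the sign-blind running coupling `ε_{n−2} = epsCoupling P U (n−2)` (the gap of located risk #14) -/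

section Eps

/-- **The per-step (R1′) E.5 block bound at the running coupling** `g := ε_{n−2} = epsCoupling P U (n−2)` (the E1 tower's currency of record for the
degrees `≥ 6`, `KernelNormsLevels … (K_n) (n−2)`; `Klam·U ≤ ε` covers the quartic): under §11's binders, with the law keyed at `ε_{n−2}` and the
smallness `528·Cκ·e₀·Θ·ε_{n−2} ≤ 1` (a `cc`-smallness in the regime, since `ε_{n−2} ≤ Klam·(U + cc/ln 4)` — (E5-EPS-cc)),
`‖klE5BlockR1 … K (n−1) Λ Qm x y‖·(Λ_{n−1} − Λ_n) ≤ ((4!·13⁴·1680·2⁹·88²·3·(16Cα)·(512Cκ)²·CA)·e₀)·ε_{n−2}³·2^{−n}` — the honest per-step cube is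
`ε_{n−2}³ = (Klam·U)³·(1 + U(n−2))³` (`epsCoupling_pow_three_eq`), NOT `(Klam·U)³` (FINDING (E5-EPS)).
[cite: BenfattoGiulianiMastropietro2006, §2.8 (2.80); Lemma 2.5 (2.98)] -/
theorem klE5BlockR1_slice_le_of_rows_eps :
    ∃ Cκ : ℝ, 0 < Cκ ∧ ∀ (P : SplitConsts) (R : RenConsts) (cc : ℝ), P.WF → R.WF2 → 0 < cc → cc ≤ klEngC₃3 P R →
      ∀ μ ∈ klWindowC, ∀ U : ℝ, 0 < U → U ≤ klEngU₀4 P R cc → ∀ β : ℝ, klBetaMin ≤ β → β ≤ Real.exp (cc / U ^ 2) →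
      ∀ K : TrigPolyC4v, FrameOK R U (nScales β) μ K → ∀ (L M : ℕ) [NeZero L] [NeZero M],
      klEngL₃ β U ≤ L → klEngM₃ β U L ≤ M → ∀ n : ℕ, 3 ≤ n → n ≤ nScales β + 1 →
      ∀ Λ ∈ Set.Icc (klScale klE0 n) (klScale klE0 (n - 1)), ∀ (Qm : TorusSite 2 L) (x y : TorusSite 2 L × MatsubaraIdx M),
      ∀ (Cα C₀ Θ CA : ℝ), 0 ≤ Cα → 0 ≤ C₀ → 1 ≤ Θ → C₀ ^ 2 * Θ ^ 5 / 64 ≤ CA → 528 * Cκ * klE0 * Θ * epsCoupling P U (n - 2) ≤ 1 →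
      ∀ α : ℝ, 0 ≤ α →
        (∀ X, ∑ Y, ‖((sectorSubMatrix L M β (bgmFatMultiplier L M klE0 β (nambuXiCT L μ K) (n - 2))).transpose *
          normalCovariance L M (fun ks => ((klScale klE0 (n - 1) - klScale klE0 n : ℝ) : ℂ) *
            klE5DerivLineSym L M β μ K (n - 1) (klE5Kappa L M β U μ K (n - 1)) Λ ks) *
          sectorSubMatrix L M β (bgmFatMultiplier L M klE0 β (nambuXiCT L μ K) (n - 2))) X Y‖ ≤ α) →
        (∀ Y, ∑ X, ‖((sectorSubMatrix L M β (bgmFatMultiplier L M klE0 β (nambuXiCT L μ K) (n - 2))).transpose *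
          normalCovariance L M (fun ks => ((klScale klE0 (n - 1) - klScale klE0 n : ℝ) : ℂ) *
            klE5DerivLineSym L M β μ K (n - 1) (klE5Kappa L M β U μ K (n - 1)) Λ ks) *
          sectorSubMatrix L M β (bgmFatMultiplier L M klE0 β (nambuXiCT L μ K) (n - 2))) X Y‖ ≤ α) →
        (∀ ks : FreqMomentum L M × Fin 2, ‖klE5SliceSym L M β μ K (n - 1) (klScale klE0 n) ks * klE5Kappa L M β U μ K (n - 1) ks‖ ≤ 1 / 2 ∧
          ‖klE5SliceSym L M β μ K (n - 1) Λ ks * klE5Kappa L M β U μ K (n - 1) ks‖ ≤ 1 / 2) →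
        (∀ m : ℕ, 4 ≤ m → Even m → ∀ Ωe : Fin m → Option (SectorLeg (sectorCount (n - 2) + 4)),
          hubbardSectorKernelNorm L M β (pointAugment (klAnisoFamily L M β μ K klE0 (n - 2)) (klE5ExtMomenta Qm x y)) (prescribedTuples univ Ωe)
            (klE5Carrier L M β μ K (n - 1) (klE5Kappa L M β U μ K (n - 1)) (klE5Input L M β U μ K (n - 1)) Λ) ≤
            C₀ * Θ ^ (m / 2) * epsCoupling P U (n - 2) ^ (m / 2 - 1) * (2 : ℝ) ^ ((3 * (m / 2) - 5) * (n - 2)) *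
              (((2 : ℝ) ^ (n - 2))⁻¹) ^ levelGainExp (levelCount Ωe)) →
        (∀ m : ℕ, ¬ Even m → ∀ Ωe : Fin m → Option (SectorLeg (sectorCount (n - 2) + 4)),
          hubbardSectorKernelNorm L M β (pointAugment (klAnisoFamily L M β μ K klE0 (n - 2)) (klE5ExtMomenta Qm x y)) (prescribedTuples univ Ωe)
            (klE5Carrier L M β μ K (n - 1) (klE5Kappa L M β U μ K (n - 1)) (klE5Input L M β U μ K (n - 1)) Λ) ≤ 0) →
        α ≤ (klScale klE0 (n - 1) - klScale klE0 n) * (Cα * (imagTimeWeight β M)⁻¹ * (16 : ℝ) ^ n / klE0 ^ 2) →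
        ‖klE5BlockR1 L M β U μ K (n - 1) Λ Qm x y‖ * (klScale klE0 (n - 1) - klScale klE0 n) ≤
          ((((4 : ℕ).factorial : ℝ) * 13 ^ 4 * (1680 * 2 ^ 9) * 88 ^ 2 * 3 * (16 * Cα) * (512 * Cκ) ^ 2 * CA) * klE0) *
            epsCoupling P U (n - 2) ^ 3 * ((2 : ℝ) ^ n)⁻¹ := by
  obtain ⟨Cκ, hCκ, h⟩ := klE5BlockR1_slice_le_of_rows_generic
  refine ⟨Cκ, hCκ, ?_⟩
  intro P R cc hP hR hcc hcc3 μ hμ U hU hU4 β hβ hβc K hF L M _ _ hL hM n h3n hnN Λ hΛ Qm x y Cα C₀ Θ CA hCα hC₀ hΘ hCA hsmall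
    α hα hrow hcol hsm hlaw hodd hαs
  have hK : 0 ≤ P.Klam := zero_le_one.trans hP.1
  exact h P R cc hP hR hcc hcc3 μ hμ U hU hU4 β hβ hβc K hF L M hL hM n h3n hnN Λ hΛ Qm x y Cα C₀ Θ CA (epsCoupling P U (n - 2)) hCα hC₀ hΘ hCA
    (epsCoupling_nonneg' hK U (n - 2)) hsmall α hα hrow hcol hsm hlaw hodd hαs

/-- **The same with the cube presented at `ε_n`** (`ε_{n−2} ≤ ε_n`): the shape a successor step text keyed at the step's own scale would carry,
`… ≤ C·e₀·(epsCoupling P U n)³·2^{−n}`. [cite: BenfattoGiulianiMastropietro2006, §2.8 (2.80)] -/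
theorem klE5BlockR1_slice_le_of_rows_eps' :
    ∃ Cκ : ℝ, 0 < Cκ ∧ ∀ (P : SplitConsts) (R : RenConsts) (cc : ℝ), P.WF → R.WF2 → 0 < cc → cc ≤ klEngC₃3 P R →
      ∀ μ ∈ klWindowC, ∀ U : ℝ, 0 < U → U ≤ klEngU₀4 P R cc → ∀ β : ℝ, klBetaMin ≤ β → β ≤ Real.exp (cc / U ^ 2) →
      ∀ K : TrigPolyC4v, FrameOK R U (nScales β) μ K → ∀ (L M : ℕ) [NeZero L] [NeZero M],
      klEngL₃ β U ≤ L → klEngM₃ β U L ≤ M → ∀ n : ℕ, 3 ≤ n → n ≤ nScales β + 1 →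
      ∀ Λ ∈ Set.Icc (klScale klE0 n) (klScale klE0 (n - 1)), ∀ (Qm : TorusSite 2 L) (x y : TorusSite 2 L × MatsubaraIdx M),
      ∀ (Cα C₀ Θ CA : ℝ), 0 ≤ Cα → 0 ≤ C₀ → 1 ≤ Θ → C₀ ^ 2 * Θ ^ 5 / 64 ≤ CA → 528 * Cκ * klE0 * Θ * epsCoupling P U (n - 2) ≤ 1 →
      ∀ α : ℝ, 0 ≤ α →
        (∀ X, ∑ Y, ‖((sectorSubMatrix L M β (bgmFatMultiplier L M klE0 β (nambuXiCT L μ K) (n - 2))).transpose *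
          normalCovariance L M (fun ks => ((klScale klE0 (n - 1) - klScale klE0 n : ℝ) : ℂ) *
            klE5DerivLineSym L M β μ K (n - 1) (klE5Kappa L M β U μ K (n - 1)) Λ ks) *
          sectorSubMatrix L M β (bgmFatMultiplier L M klE0 β (nambuXiCT L μ K) (n - 2))) X Y‖ ≤ α) →
        (∀ Y, ∑ X, ‖((sectorSubMatrix L M β (bgmFatMultiplier L M klE0 β (nambuXiCT L μ K) (n - 2))).transpose *
          normalCovariance L M (fun ks => ((klScale klE0 (n - 1) - klScale klE0 n : ℝ) : ℂ) *
            klE5DerivLineSym L M β μ K (n - 1) (klE5Kappa L M β U μ K (n - 1)) Λ ks) *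
          sectorSubMatrix L M β (bgmFatMultiplier L M klE0 β (nambuXiCT L μ K) (n - 2))) X Y‖ ≤ α) →
        (∀ ks : FreqMomentum L M × Fin 2, ‖klE5SliceSym L M β μ K (n - 1) (klScale klE0 n) ks * klE5Kappa L M β U μ K (n - 1) ks‖ ≤ 1 / 2 ∧
          ‖klE5SliceSym L M β μ K (n - 1) Λ ks * klE5Kappa L M β U μ K (n - 1) ks‖ ≤ 1 / 2) →
        (∀ m : ℕ, 4 ≤ m → Even m → ∀ Ωe : Fin m → Option (SectorLeg (sectorCount (n - 2) + 4)),
          hubbardSectorKernelNorm L M β (pointAugment (klAnisoFamily L M β μ K klE0 (n - 2)) (klE5ExtMomenta Qm x y)) (prescribedTuples univ Ωe)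
            (klE5Carrier L M β μ K (n - 1) (klE5Kappa L M β U μ K (n - 1)) (klE5Input L M β U μ K (n - 1)) Λ) ≤
            C₀ * Θ ^ (m / 2) * epsCoupling P U (n - 2) ^ (m / 2 - 1) * (2 : ℝ) ^ ((3 * (m / 2) - 5) * (n - 2)) *
              (((2 : ℝ) ^ (n - 2))⁻¹) ^ levelGainExp (levelCount Ωe)) →
        (∀ m : ℕ, ¬ Even m → ∀ Ωe : Fin m → Option (SectorLeg (sectorCount (n - 2) + 4)),
          hubbardSectorKernelNorm L M β (pointAugment (klAnisoFamily L M β μ K klE0 (n - 2)) (klE5ExtMomenta Qm x y)) (prescribedTuples univ Ωe)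
            (klE5Carrier L M β μ K (n - 1) (klE5Kappa L M β U μ K (n - 1)) (klE5Input L M β U μ K (n - 1)) Λ) ≤ 0) →
        α ≤ (klScale klE0 (n - 1) - klScale klE0 n) * (Cα * (imagTimeWeight β M)⁻¹ * (16 : ℝ) ^ n / klE0 ^ 2) →
        ‖klE5BlockR1 L M β U μ K (n - 1) Λ Qm x y‖ * (klScale klE0 (n - 1) - klScale klE0 n) ≤
          ((((4 : ℕ).factorial : ℝ) * 13 ^ 4 * (1680 * 2 ^ 9) * 88 ^ 2 * 3 * (16 * Cα) * (512 * Cκ) ^ 2 * CA) * klE0) *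
            epsCoupling P U n ^ 3 * ((2 : ℝ) ^ n)⁻¹ := by
  obtain ⟨Cκ, hCκ, h⟩ := klE5BlockR1_slice_le_of_rows_eps
  refine ⟨Cκ, hCκ, ?_⟩
  intro P R cc hP hR hcc hcc3 μ hμ U hU hU4 β hβ hβc K hF L M _ _ hL hM n h3n hnN Λ hΛ Qm x y Cα C₀ Θ CA hCα hC₀ hΘ hCA hsmall
    α hα hrow hcol hsm hlaw hodd hαs
  have hK : 0 ≤ P.Klam := zero_le_one.trans hP.1
  have hCA0 : 0 ≤ CA := le_trans (by positivity) hCA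
  have he₀ : (0 : ℝ) < klE0 := by norm_num [klE0]
  refine (h P R cc hP hR hcc hcc3 μ hμ U hU hU4 β hβ hβc K hF L M hL hM n h3n hnN Λ hΛ Qm x y Cα C₀ Θ CA hCα hC₀ hΘ hCA hsmall
    α hα hrow hcol hsm hlaw hodd hαs).trans ?_
  have hmono : epsCoupling P U (n - 2) ^ 3 ≤ epsCoupling P U n ^ 3 :=
    pow_le_pow_left₀ (epsCoupling_nonneg' hK U (n - 2)) (epsCoupling_mono hK U (by omega)) 3
  exact mul_le_mul_of_nonneg_right (mul_le_mul_of_nonneg_left hmono (by positivity)) (by positivity)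

end Eps

end Summit.HubbardSuperconductivity.HubbardSuperconductivity.Theorems.KLRegimeSplit

end
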